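import Summits.Ventures.PercRepro.C026DCSub
import Summits.Ventures.PercRepro.C026DirectAccess

/-!
# (2×) on `H − e` and `H / e` gives (CF) on `H` at a `c`-edge — mine-3's corollary of Theorem C (p5, gen 15)

mine-3 (`proofs/MINE3-FLIPS.md` §1, §4): `N_AB` splits as `{a ~_S b by a path avoiding D} ⊔ N²`, and the first
part is in bijection with `ab|c` under the closed-cluster flip `Φ` (`card_nAB_connAvoid_eq_card_cell_ab`), so
`Δ_CF = #ac|b + #bc|a − #N²` (`slackCF_eq`) and `(2×)`, `2·#N² ≤ #ac|b + #bc|a` (`TwoTimes`), gives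
`#ac|b + #bc|a ≤ 2·Δ_CF` (`two_mul_slackCF_ge`). With Theorem C (`DB(cv) ⊆ ac|b(G) ⊔ bc|a(G)` and
`#DB(cv) ≤ #ac|b(H / e) + #bc|a(H / e)`) and DC-SUB this is the triangle inequality
`|Δ_CF(H − e) − Δ_CF(H / e)| ≤ Δ_CF(H)` at the `c`-edge, hence **`slackCF_addEdge_nonneg_of_twoTimes`**:
(2×) on `G = H − e` and on `H / e` implies (CF), `0 ≤ Δ_CF(H)`, for `H = G + vc` (`v` not a mark); at an
`a/b`-edge, Theorem Q′ gives direction (i), `#DB(xb) ≤ 2·Δ_CF(H / e)` (`card_dcDefect_xb_le_two_mul_slackCF`).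
mine-3's identity (2) (INBOX 17:51Z): `#N² = #{Λ, a ~_S b, a ≁_{S̄} b} − #{Λ, a ≁_S b, a ~_{S̄} b}` with
`Λ = {a ∉ D, b ∉ D}` (`card_nTwo_add_eq`, from the complement bijection `card_cell_ab_eq_card_compl`), so
(2×) reads `2·(#Λ_{o·} − #Λ_{·o}) ≤ #{exactly one mark in D}` (`twoTimes_iff_lambda`).
-/

namespace PercRepro

open Finset

namespace MultiGraph

section TwoTimesCF

variable {V E : Type*} (G : MultiGraph V E)

open Classical in
/-- **mine-3's (2×)**: `2·#N² ≤ #ac|b + #bc|a`. -/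
def TwoTimes [Fintype E] (a b c : V) : Prop :=
  2 * (univ.filter fun ω : Config E => G.NTwo ω a b c).card ≤
    (univ.filter fun ω : Config E => G.Conn ω c a ∧ ¬ G.Conn ω c b).card +
      (univ.filter fun ω : Config E => G.Conn ω c b ∧ ¬ G.Conn ω c a).card

variable {G}

/-- `DB(e)` is symmetric in the two ends of `e`. -/
theorem dcDefect_comm {ω : Config E} {a b c u v : V} :
    G.DCDefect ω a b c u v ↔ G.DCDefect ω a b c v u := by
  unfold DCDefect
  constructor
  · rintro ⟨hab, hop, hca, hcb, hcl⟩
    exact ⟨hab, hop.symm, hca, hcb, hcl.symm⟩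
  · rintro ⟨hab, hop, hca, hcb, hcl⟩
    exact ⟨hab, hop.symm, hca, hcb, hcl.symm⟩

/-- An open walk of `S` avoiding `D = Com_c(S̄)` survives in the closed-cluster flip `Φ(S)`. -/
theorem conn_kSwapInv_of_connAvoid {c : V} {ω : Config E} {x y : V}
    (h : G.ConnAvoid ω (G.cluster ωᶜ c) x y) : G.Conn (G.kSwapInv c ω) x y := by
  unfold ConnAvoid at h
  induction h with
  | refl => exact Conn.refl G _ x
  | tail _ hxy ih =>
    obtain ⟨⟨e, he, hend⟩, hx, hy⟩ := hxy
    refine ih.tail ⟨e, ?_, hend⟩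
    rw [kSwapInv_apply_of_notMem (notMem_edgesAt_of_ends_notMem hend hx hy)]
    exact he

/-- An open walk of `T` from a vertex `x ≁_T c` never meets `K = Com_c(T)` and uses only edges away from `K`,
so it is an open walk of the open-cluster flip `kSwap c T` avoiding `K = Com_c((kSwap c T)ᶜ)`. -/
theorem connAvoid_kSwap_of_conn {c : V} {τ : Config E} {x y : V} (hx : ¬ G.Conn τ c x)
    (h : G.Conn τ x y) : G.ConnAvoid (G.kSwap c τ) (G.cluster (G.kSwap c τ)ᶜ c) x y := by
  rw [G.cluster_compl_kSwap]
  unfold ConnAvoid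
  refine Conn.induction (motive := fun z => ¬ G.Conn τ c z ∧
    Relation.ReflTransGen (fun p q => G.OpenAdj (G.kSwap c τ) p q ∧ p ∉ G.cluster τ c ∧ q ∉ G.cluster τ c) x z)
    ⟨hx, Relation.ReflTransGen.refl⟩ ?_ h |>.2
  intro z w _ hzw ⟨hz, hwalk⟩
  obtain ⟨e, he, hend⟩ := hzw
  have hw : ¬ G.Conn τ c w := fun hw => hz (hw.trans (Conn.of_openAdj ⟨e, he, hend⟩).symm)
  have heK : e ∉ G.edgesAt (G.cluster τ c) := notMem_edgesAt_of_ends_notMem hend hz hw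
  refine ⟨hw, hwalk.tail ⟨⟨e, ?_, hend⟩, hz, hw⟩⟩
  rw [G.kSwap_apply_of_notMem heK]
  exact he

open Classical in
/-- **The split of `N_AB`** (mine-3 §1, Remark): the configurations of `N_AB` in which `a ~ b` by a walk avoiding
`D` are as many as the cell `ab|c` — `Φ` carries them onto it. -/
theorem card_nAB_connAvoid_eq_card_cell_ab [Fintype E] (a b c : V) :
    (univ.filter fun ω : Config E => G.Conn ω a b ∧ ¬ G.Conn ωᶜ c a ∧ ¬ G.Conn ωᶜ c b ∧
        G.ConnAvoid ω (G.cluster ωᶜ c) a b).card =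
      (univ.filter fun ω : Config E => G.Conn ω a b ∧ ¬ G.Conn ω a c).card := by
  refine Finset.card_nbij' (G.kSwapInv c) (G.kSwap c) ?_ ?_ ?_ ?_
  · intro ω hω
    simp only [Finset.coe_filter, Finset.mem_univ, true_and, Set.mem_setOf_eq] at hω ⊢
    obtain ⟨_, hca, _, hav⟩ := hω
    refine ⟨conn_kSwapInv_of_connAvoid hav, fun hac => hca ?_⟩
    exact (conn_kSwapInv_iff c a ω).mp hac.symm
  · intro τ hτ
    simp only [Finset.coe_filter, Finset.mem_univ, true_and, Set.mem_setOf_eq] at hτ ⊢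
    obtain ⟨hab, hac⟩ := hτ
    have hca : ¬ G.Conn τ c a := fun h => hac h.symm
    have hcb : ¬ G.Conn τ c b := fun h => hac (hab.trans h.symm)
    refine ⟨?_, ?_, ?_, connAvoid_kSwap_of_conn hca hab⟩
    · exact (connAvoid_kSwap_of_conn hca hab).conn
    · rw [G.conn_compl_kSwap_iff]
      exact hca
    · rw [G.conn_compl_kSwap_iff]
      exact hcb
  · intro ω _
    exact kSwap_kSwapInv c ω
  · intro τ _
    exact kSwapInv_kSwap c τ

open Classical in
/-- `#N_AB = #ab|c + #N²`. -/
theorem card_nAB_eq [Fintype E] (a b c : V) :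
    (univ.filter fun ω : Config E => G.Conn ω a b ∧ ¬ G.Conn ωᶜ c a ∧ ¬ G.Conn ωᶜ c b).card =
      (univ.filter fun ω : Config E => G.Conn ω a b ∧ ¬ G.Conn ω a c).card +
        (univ.filter fun ω : Config E => G.NTwo ω a b c).card := by
  rw [← card_nAB_connAvoid_eq_card_cell_ab a b c, ← Finset.card_union_of_disjoint]
  · congr 1
    ext ω
    simp only [Finset.mem_filter, Finset.mem_univ, true_and, Finset.mem_union, NTwo]
    tauto
  · rw [Finset.disjoint_filter]
    intro ω _ h1 h2
    exact h2.2.2.2 h1.2.2.2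

open Classical in
/-- **`Δ_CF = #ac|b + #bc|a − #N²`** (mine-3 §1). -/
theorem slackCF_eq [Fintype E] (a b c : V) :
    G.slackCF a b c =
      ((univ.filter fun ω : Config E => G.Conn ω c a ∧ ¬ G.Conn ω c b).card : ℤ) +
        ((univ.filter fun ω : Config E => G.Conn ω c b ∧ ¬ G.Conn ω c a).card : ℤ) -
        ((univ.filter fun ω : Config E => G.NTwo ω a b c).card : ℤ) := by
  unfold slackCF
  rw [card_nAB_eq a b c]
  push_cast
  ring

open Classical in
/-- Under (2×), `#ac|b + #bc|a ≤ 2·Δ_CF`. -/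
theorem two_mul_slackCF_ge [Fintype E] {a b c : V} (h : G.TwoTimes a b c) :
    ((univ.filter fun ω : Config E => G.Conn ω c a ∧ ¬ G.Conn ω c b).card : ℤ) +
        ((univ.filter fun ω : Config E => G.Conn ω c b ∧ ¬ G.Conn ω c a).card : ℤ) ≤
      2 * G.slackCF a b c := by
  rw [slackCF_eq]
  unfold TwoTimes at h
  omega

open Classical in
/-- **Theorem C (a), counted**: `#DB(cv) ≤ #ac|b(G) + #bc|a(G)`. -/
theorem card_dcDefect_cv_le_cells [Fintype E] (a b c v : V) :
    (univ.filter fun ω : Config E => G.DCDefect ω a b c c v).card ≤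
      (univ.filter fun ω : Config E => G.Conn ω c a ∧ ¬ G.Conn ω c b).card +
        (univ.filter fun ω : Config E => G.Conn ω c b ∧ ¬ G.Conn ω c a).card := by
  refine le_trans (Finset.card_le_card ?_) (Finset.card_union_le _ _)
  intro ω hω
  simp only [Finset.mem_filter, Finset.mem_univ, true_and, Finset.mem_union] at hω ⊢
  exact dcDefect_cv_mem_cell hω

open Classical in
/-- **(2×) on `H − e` and on `H / e` gives (CF) on `H` at a `c`-edge** (mine-3's corollary of Theorem C, the
triangle inequality at one edge): for `H = G + vc` with `v ∉ {a, b, c}`, `0 ≤ Δ_CF(H)` whenever (2×) holds on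
`G` and on `H / e = G.contract v c`. -/
theorem slackCF_addEdge_nonneg_of_twoTimes [Fintype E] {a b c v : V} (hva : v ≠ a) (hvb : v ≠ b)
    (hvc : v ≠ c) (hG : G.TwoTimes a b c) (hC : (G.contract v c).TwoTimes a b c) :
    0 ≤ (G.addEdge v c).slackCF a b c := by
  rw [slackCF_addEdge (Ne.symm hvc) (Ne.symm hva) (Ne.symm hvb) (Ne.symm hvc)]
  -- `#DB(cv) ≤ 2 Δ_CF(G)` and `#DB(cv) ≤ 2 Δ_CF(H / e)`
  have hDB : (univ.filter fun ω : Config E => G.DCDefect ω a b c v c) =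
      (univ.filter fun ω : Config E => G.DCDefect ω a b c c v) := by
    ext ω
    simp only [Finset.mem_filter, Finset.mem_univ, true_and]
    exact dcDefect_comm
  have h1 := card_dcDefect_cv_le_cells (G := G) a b c v
  have h2 := card_dcDefect_cv_le (G := G) (a := a) (b := b) (c := c) (v := v) (Ne.symm hva)
    (Ne.symm hvb)
  have h3 := two_mul_slackCF_ge hG
  have h4 := two_mul_slackCF_ge hC
  rw [hDB]
  omega

open Classical in
/-- The cell `bc|a` in its two spellings: `c ~ b ∧ a ≁ b` and `c ~ b ∧ c ≁ a`. -/
theorem filter_cell_bc_eq [Fintype E] (G' : MultiGraph V E) (a b c : V) :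
    (univ.filter fun ω : Config E => G'.Conn ω c b ∧ ¬ G'.Conn ω a b) =
      (univ.filter fun ω : Config E => G'.Conn ω c b ∧ ¬ G'.Conn ω c a) := by
  refine Finset.filter_congr fun ω _ => ?_
  constructor
  · rintro ⟨hcb, hab⟩
    exact ⟨hcb, fun hca => hab (hca.symm.trans hcb)⟩
  · rintro ⟨hcb, hca⟩
    exact ⟨hcb, fun hab => hca (hcb.trans hab.symm)⟩

open Classical in
/-- **Direction (i) of the triangle inequality at an `a/b`-edge** (mine-3's corollary of Theorem Q′): under
(2×) on `H / e`, `#DB(xb) ≤ 2·Δ_CF(H / e)` (`e = xb`, `x ≠ c`, `H / e = G.contract x b`). -/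
theorem card_dcDefect_xb_le_two_mul_slackCF [Fintype E] {c x : V} (hcx : c ≠ x) {a b : V}
    (h : (G.contract x b).TwoTimes a b c) :
    ((univ.filter fun ω : Config E => G.DCDefect ω a b c x b).card : ℤ) ≤
      2 * (G.contract x b).slackCF a b c := by
  have h1 := card_dcDefect_xb_le (G := G) hcx a b
  rw [filter_cell_bc_eq] at h1
  have h2 := two_mul_slackCF_ge h
  omega

open Classical in
/-- **The complement bijection**: `#ab|c = #{S : a, b ∉ D, a ~_{S̄} b}` (`S ↦ S̄`). -/
theorem card_cell_ab_eq_card_compl [Fintype E] (a b c : V) :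
    (univ.filter fun ω : Config E => G.Conn ω a b ∧ ¬ G.Conn ω a c).card =
      (univ.filter fun ω : Config E =>
        (¬ G.Conn ωᶜ c a ∧ ¬ G.Conn ωᶜ c b) ∧ G.Conn ωᶜ a b).card := by
  refine Finset.card_nbij' (fun ω => ωᶜ) (fun ω => ωᶜ) ?_ ?_ ?_ ?_
  · intro ω hω
    simp only [Finset.coe_filter, Finset.mem_univ, true_and, Set.mem_setOf_eq, compl_compl] at hω ⊢
    exact ⟨⟨fun h => hω.2 h.symm, fun h => hω.2 (hω.1.trans h.symm)⟩, hω.1⟩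
  · intro ω hω
    simp only [Finset.coe_filter, Finset.mem_univ, true_and, Set.mem_setOf_eq] at hω ⊢
    exact ⟨hω.2, fun h => hω.1.1 h.symm⟩
  · intro ω _
    exact compl_compl ω
  · intro ω _
    exact compl_compl ω

open Classical in
/-- **mine-3's identity (2)** (INBOX 17:51Z): with `Λ = {a ∉ D, b ∉ D}`,
`#N² + #{Λ, a ≁_S b, a ~_{S̄} b} = #{Λ, a ~_S b, a ≁_{S̄} b}`, i.e. `#N² = #Λ_{o·} − #Λ_{·o}`. -/
theorem card_nTwo_add_eq [Fintype E] (a b c : V) :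
    (univ.filter fun ω : Config E => G.NTwo ω a b c).card +
        (univ.filter fun ω : Config E =>
          (¬ G.Conn ωᶜ c a ∧ ¬ G.Conn ωᶜ c b) ∧ ¬ G.Conn ω a b ∧ G.Conn ωᶜ a b).card =
      (univ.filter fun ω : Config E =>
        (¬ G.Conn ωᶜ c a ∧ ¬ G.Conn ωᶜ c b) ∧ G.Conn ω a b ∧ ¬ G.Conn ωᶜ a b).card := by
  have h1 := card_nAB_eq (G := G) a b c
  have h2 := card_cell_ab_eq_card_compl (G := G) a b c
  -- split `N_AB` and the complement set by the state of `a ~_{S̄} b` / `a ~_S b`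
  have h3 : (univ.filter fun ω : Config E => G.Conn ω a b ∧ ¬ G.Conn ωᶜ c a ∧ ¬ G.Conn ωᶜ c b).card =
      (univ.filter fun ω : Config E =>
          (¬ G.Conn ωᶜ c a ∧ ¬ G.Conn ωᶜ c b) ∧ G.Conn ω a b ∧ G.Conn ωᶜ a b).card +
        (univ.filter fun ω : Config E =>
          (¬ G.Conn ωᶜ c a ∧ ¬ G.Conn ωᶜ c b) ∧ G.Conn ω a b ∧ ¬ G.Conn ωᶜ a b).card := by
    rw [← Finset.card_filter_add_card_filter_not (fun ω : Config E => G.Conn ωᶜ a b),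
      Finset.filter_filter, Finset.filter_filter]
    congr 1 <;> congr 1 <;> exact Finset.filter_congr fun ω _ => by tauto
  have h4 : (univ.filter fun ω : Config E =>
      (¬ G.Conn ωᶜ c a ∧ ¬ G.Conn ωᶜ c b) ∧ G.Conn ωᶜ a b).card =
      (univ.filter fun ω : Config E =>
          (¬ G.Conn ωᶜ c a ∧ ¬ G.Conn ωᶜ c b) ∧ G.Conn ω a b ∧ G.Conn ωᶜ a b).card +
        (univ.filter fun ω : Config E =>
          (¬ G.Conn ωᶜ c a ∧ ¬ G.Conn ωᶜ c b) ∧ ¬ G.Conn ω a b ∧ G.Conn ωᶜ a b).card := by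
    rw [← Finset.card_filter_add_card_filter_not (fun ω : Config E => G.Conn ω a b),
      Finset.filter_filter, Finset.filter_filter]
    congr 1 <;> congr 1 <;> exact Finset.filter_congr fun ω _ => by tauto
  omega

open Classical in
/-- **(2×) in the form of identity (2)**: `2·(#Λ_{o·} − #Λ_{·o}) ≤ #{exactly one mark in D}`
(`card_oneMark_compl_eq`: the right side is `#ac|b + #bc|a`). -/
theorem twoTimes_iff_lambda [Fintype E] (a b c : V) :
    G.TwoTimes a b c ↔
      2 * (univ.filter fun ω : Config E =>
          (¬ G.Conn ωᶜ c a ∧ ¬ G.Conn ωᶜ c b) ∧ G.Conn ω a b ∧ ¬ G.Conn ωᶜ a b).card ≤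
        (univ.filter fun ω : Config E =>
          (G.Conn ωᶜ c a ∧ ¬ G.Conn ωᶜ c b) ∨ (G.Conn ωᶜ c b ∧ ¬ G.Conn ωᶜ c a)).card +
          2 * (univ.filter fun ω : Config E =>
            (¬ G.Conn ωᶜ c a ∧ ¬ G.Conn ωᶜ c b) ∧ ¬ G.Conn ω a b ∧ G.Conn ωᶜ a b).card := by
  unfold TwoTimes
  rw [card_oneMark_compl_eq, ← card_nTwo_add_eq a b c]
  omega

end TwoTimesCF

end MultiGraph

end PercRepro
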